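import Summits.QuantumFields.YangMills.Theses.BalabanUVNodes
import Summits.QuantumFields.YangMills.Theorems.BalabanUVNodesN27AtAllPinsOfRecord13CoPHVCutBFreeBareLedgerReadingN16Produced
import Summits.QuantumFields.YangMills.Theorems.BalabanUVNodesN20OffLiveOneTermReading
import Summits.QuantumFields.YangMills.Theorems.BalabanUVNodesN18U3LettersOfLocalTermsPackageTermwise
import Summits.QuantumFields.YangMills.Theorems.BalabanUVNodesN18KernelStepRateKingMechanismWindowed

/-!
# ★★★ K3⁸ LEAF AWB16ⱽ-1T-U3T (dag-n27-c g17, trigger (t2⁗)): THE ITEM `Theses.BalabanUVNodes.SpineGivenEndpointR13SepCoPHV` AT EVERY VERSION SLOT `v` — LEAF AWB16ⱽ-1T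
# (`…VAllPinsOfRecordVBFreeBareLedgerReadingN16ProducedOneTerm`, p643027: N19′ at dag-n19-w3's BARE LEDGER READING with node N16's leaf rows PRODUCED by dag-n16-w4's p640452 §4, off-live
# ONE (B)-free target row at dag-n20-w1's `crOneTerm₁₃ K₀`) WITH NODE U3's THREE LETTER ROWS `hr ∕ hinc ∕ hS` (and the letters `s r`) **PRODUCED** FROM dag-n18-w2 g10's TERM-DATA
# PACKAGE `YMDAG.N18.U3LettersPackage.u3LettersOfRecord₁₃_of_termwiseLocalTermData` (`…N18U3LettersOfLocalTermsPackageTermwise`, p643904; consumer map of record INBOX l.40269) —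
# the sibling of AWBⱽ-1T-U3T `…VBFreeBareLedgerReadingOneTermU3TermData` with `hH3 hsel3` ↦ `ρ c εTop hloose hρε hεT h8P hU6loc hρb hc`: per tuple `(F, θ)` — W1-20's law
# `hloc : Localizes17OfRecord₁₃ F 2 θ.toStage13Params (S F θ) (emb F θ)`, ONE `(κ, δ₀, ω, c_ρ, r, E₀, B₃, θ₅, M₀)` (`M = L^{m′}`), (P1) the single-run analytic data `ι₁ G₁ U₁` with
# (4.35) tails and (1.18) sup decay, (P2′) the local domain matching `φ` + the per-term volume-independence rate, (P3) the two-run holomorphic data `ιc GB GA U` with the TERM-LEVEL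
# two-run sup bound — binder texts VERBATIM from p643904 under the family-indexing substitution `x ↦ x F θ` (`N := 2`, `θ := θ.toStage13Params`), content rows guarded by
# `Provisos₁₃CoPH → guard → Admissible`, plus three KEYING rows `hℓκ ∕ hℓθ ∕ hℓC` by DOMINATION — `(ℓ F θ).κ ≤ δ₁`, `θ₅ ≤ (ℓ F θ).θ₅`, `C₅′·θ₅ ≤ (ℓ F θ).C₅·(ℓ F θ).θ₅` (dag-n18-w2's
# `…Pins` p641019 equations are the special case).  Body = p643027's VERBATIM with `s := fun _ _ => 1`, `r := r_inc = max{ω^{1∕2}, e^{−ηc′}}` and `hr ∕ hinc ∕ hS :=` conjuncts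
# 1 ∕ 2 ∕ 4 of the package (`hS` carried to the letters by dag-n18-w4's `windowedStepRateOfRecord₁₃_mono` (p608767), with `0 ≤ C₅·θ₅` from `Signs`); storey APB16ᴮ
# `bodyBFree₁₃CoPH_of_v5pins_bareLedgerReadingV_n16Produced_at_crOfRecord₁₃VAt_cut` (p642685), (Kꜰ)ᴮ, FILE 1 `bodyBFree₁₃CoPH_of_split` + `hybridNE7Under_of_forSmallCouplings_stringwise` at
# `Node00.datumOfRecord₁₃SepCoPHV F 2 θ h v` — all BY NAME, unchanged.
# (cell `pub-ymgap`, D-0062 Track A, seat `pub-ymgap-dag-n27-c` gen 17; `--kind proof --supports stmt-QuantumFields-27366 --as helper`; COUNT-NEUTRAL; ONE theorem, 0 `def`, 0 `sorry`;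
# a route-facing leaf, nothing may import it)

THE ITEM then costs: the pins · `h16` · `hs hκ hcr hκ₀` at the letter reading `ℓ` · NODE U3's TERM DATA (`hM hloc hκ0 hδ₀ hκ4 hω hω1 hcρ hr0 hE₀ hB₃ hU₁ hG₁ hrU₁ hf₁ hsup₁ htail₁ hφ hterm
hθ₅ hM₀ hU hGB hGA hrU hfB hfA hsup htail` + `hℓκ hℓθ hℓC`) · the n22 lane's `h9 hWall` · `hβ23 hβ1 hmatch hend hradii hclass` · N07 ∕ N16's family-level in-edges `ρ c εTop hloose hρε
hεT h8P hU6loc hρb hc` · K1's window `hβw` · live `hζm h20 h21 hlinkBareV` · off-live `htarget` ((B)-FREE) — the bill in which node N16's leaf rows AND node U3's letter rows are both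
replaced by their producers' inputs.

HONEST FRAMING.  COMPOSITE-node bookkeeping BY NAME; NOT a discharge: a term of the item's type under displayed hypotheses (audit `proof.conditional`), every one a HYPOTHESIS inhabited for no
family today (K0⁷ `Record13SepCoPHInhabited` OPEN) or a decided MODEL behind a pin; W1-20's law (1.7), the analytic term representations with (4.35) tails and (1.18) decay (NODE A ∕ N10
content), the local domain matching (lattice geometry, definer lane), the per-term volume-independence rate and the TERM-LEVEL TWO-RUN SUP BOUND (node N18's content, NOT PRINTED for
d = 4) are DISPLAYED hypotheses, asserted for no family; nothing of the merged term (1.6) or of the (2.13) terms constructed; `hlinkBareV` = NODE O's world at the runs of record (BARE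
link-reading ledger) — UNPRINTED content for d = 4, 0 instances; N11 NOT READ; `hloose`∕`h8P`∕`hU6loc` = node N07's [Balaban1985Variational] Thm 1 content in dag-n16-w4's located readings,
DISPLAYED, asserted for no family, NOT proved; the Target `htarget` and every rate are HYPOTHESES, NOT PRINTED for d = 4; `hβw` = K1's β-window currency (K1⁹ OPEN); `hradii ∧ hclass` =
THE END's content (hypotheses); `h9 ∕ hWall ∕ hκ₀` are Bałaban-type SHAPES NOT PRINTED as such for d = 4 (n22 lane); NE7b ∕ NE7c witnesses 0∕1; `β` a LETTER; `jc sh 𝔯 ksel ℓ ℓ₃ g B c'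
ρ c εTop` and the term data `𝔸 Ec m' M S emb κ δ₀ ω cρ r E₀ B₃ θ₅ M₀ ι₁ G₁ U₁ φ ιc GB GA U` FREE (no reading minted); nothing of Bałaban's or King's asserted or instantiated; NOT
`stub_rates13HV` ∕ `stub_expansion13HV`; N07 ∕ N14–N22 ∕ N27 NOT discharged; K3⁸ OPEN, NOT claimed; skeleton v6 untouched; counts UNMOVED (typed 28∕28 · discharged 5∕27, A 5∕28); one
finite four-torus programme at fixed `ε` — R4 is the CONDITIONAL finite-𝕋⁴ rung `BalabanLadder.UV` only: NOT ℝ⁴, NOT infinite volume, NOT OS, NOT a mass gap, NOT Clay.  No decl below carries a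
cite tag (the package's TYPES cite [Balaban1987RG1], [Balaban1988RG2Cluster], [King1986] — there, not here).
-/

set_option autoImplicit false

namespace Summit.QuantumFields.YangMills.Theorems.BalabanUVNodesN27SpineRecord
open scoped BigOperators Matrix Matrix.Norms.L2Operator
open Finset MeasureTheory
open Literature.MathematicalPhysics.QuantumFieldTheory.Balaban1983to89
open T4OutputRate T4RecentScale T4GoodClassBudget T4CauchySum T4TowerRateComposition T4TowerRateDischarge
open T4EtaRateMin (Readings NE3Shape)
open T4RateLiaison (GaugeDominated)
open FlowStep (RGEqH prefixOf Box)
open TreeLengthTorus (TFaceConnected torusTreeLen TPt)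
open B12TreeDecay (kappa₀)
open Summit.QuantumFields.BalabanUV.T4Continuum
open AveragingDeficitDualResidual (dualC1 dualC2)
open AveragingDeficitDerivWallProof (wallConst)
open AveragingDeficitPeriodicCounting (IsPeriodicDir)
open MinimalActionSandwich (IsMinimiser minAct)
open MinimalActionRate (sfClass)
open MinimalActionRefine (RegularSup gradConst)
open NE3EnergyShapes (IsUnitarySite IsPeriodicSite)
open NE3.LeafIndexSockets (LeafH3sup)
open Summit.QuantumFields.BalabanUV.T4Continuum.Spine
open Summit.QuantumFields.BalabanUV.T4Continuum.Spine.NE4 (runFlow)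
open Summit.QuantumFields.BalabanUV.T4Continuum.NE1p.DressedRoot (DressedTower DressedStabilityStrict)
open Summit.QuantumFields.YangMills.BalabanUVNodes.N19LedgerLinkSync (LedgerDataSync LedgerAtSync)
open YMDAG.UVSplit
open Summit.QuantumFields.YangMills.BalabanUVNodes.N16HolderDefs (CovRootHolder N16HolderAt)
open Summit.QuantumFields.YangMills.BalabanUVNodes.SpineRatesHolder (RatesHolderAt)
open Literature.MathematicalPhysics.QuantumFieldTheory.Balaban1983to89.T4Continuum (T4Family ULoop)
open Node00 (Stage13HParams datumOfRecord₁₃CoPH SiteSeqKey U3Letters₁₁ NE3Letters₁₁ ne3ConstLayerOfRecord₁₁ ne3NperOfRecord₁₁ ne3DomOfRecord₁₁ ZetaMeasurable ppSelLiveOfRecord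
  EOfRecord₁₃ wOfRecord₉ localBgMeasurable MatA polScalar siteOfInt)
open Literature.MathematicalPhysics.QuantumFieldTheory.Balaban1983to89.B12Sec2to5 (betaPrime510)
open Literature.MathematicalPhysics.QuantumFieldTheory.Balaban1983to89.Node00.U3OfKernels (objectsOfRecord₁₃ KernelDecayOfRecord₁₃ histPrefix)
open Literature.MathematicalPhysics.QuantumFieldTheory.Balaban1983to89.Node00.U3KernelLetters (GeometricIncrementsOfRecord₁₃ WindowedNE9OfRecord₁₃ WindowedDecayOfRecord₁₃
  WindowedStepRateOfRecord₁₃)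
open Summit.QuantumFields.YangMills.BalabanUVNodes.N16PinnedLayer13CoPH (N16PinnedLoose N16LettersEnd rateCarriers_ne3_of_pinnedLoose)
open Summit.QuantumFields.YangMills.BalabanUVNodes.N19TargetClassWeightsE1Keyed
open YMDAG.N14.TopBorn (Ne1PinnedOfRecord n14At_rateCarriersOfRecord₁₃CoPH_of_pinned)
open Summit.QuantumFields.YangMills.BalabanUVNodes.N15.GenuineRecord (fullGSizedObjects n15At_fullGSizedObjects_family)
open Summit.QuantumFields.YangMills.BalabanUVNodes.N15.AtKeyedHome (neZero_blockFactor)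
open YMDAG.N18.PolLimitRate (u3KernelInputs_of_finiteVolumeLetters)
open Literature.MathematicalPhysics.QuantumFieldTheory.Balaban1983to89.Node00.LocalizedSum17 (ReadingMaps Localizes17OfRecord₁₃)
open Literature.MathematicalPhysics.QuantumFieldTheory.Balaban1983to89.Node00.Sect2 (domSys domCount)
open Literature.MathematicalPhysics.QuantumFieldTheory.Balaban1983to89.Node00.W1 (ClusterTower castDom domSys_succ)
open Literature.MathematicalPhysics.QuantumFieldTheory.Balaban1983to89.T4LevelShift (siteShift)
open Literature.MathematicalPhysics.QuantumFieldTheory.Balaban1983to89.B12PolarizationTensor120 (expChart)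
open Literature.MathematicalPhysics.QuantumFieldTheory.Balaban1983to89.B12Decay510 (delta1)
open Literature.MathematicalPhysics.QuantumFieldTheory.Balaban1983to89.B12Decay510Window (K₁)
open Literature.MathematicalPhysics.QuantumFieldTheory.Balaban1983to89.B12Decay510Torus (distCT nearT)
open YMDAG.N18.TwoRunWindowLevelShift (ladder)
open YMDAG.N18.U3LettersPackage (u3LettersOfRecord₁₃_of_termwiseLocalTermData)
open YMDAG.N18.KernelStepRateKingMechanism (windowedStepRateOfRecord₁₃_mono)
open T4WeightBudget T4IndicatorShell T4ContinuumYM4Torus T4ApexHybrid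
open Summit.QuantumFields.YangMills.Theses.BalabanUVNodes (SpineGivenEndpointR13SepCoPHV)
open NE7 (Target)
open Summit.QuantumFields.YangMills.BalabanUVNodes.N20OffLiveOneTermReading (crOneTerm₁₃ h20_shape_crOneTerm₁₃ h21_shape_crOneTerm₁₃ extraction_crOneTerm₁₃ core_crOneTerm₁₃_iff_target)
variable (K₀ : ℕ) (jc : (F : T4Family) → (θ : Stage13HParams F 2) → θ.Provisos₁₃CoPH F 2 → (ℕ → ℝ) → List (ULoop F) → ℕ → ℕ)
  (sh : ShellSplit₁₃CoPH 2 K₀)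
  (β : ℝ) (𝔯 : RateReading₁₃CoPH 2)
  (ℓ : (F : T4Family) → Stage13HParams F 2 → U3Letters₁₁)
  (ℓ₃ : T4Family → NE3Letters₁₁) (g B c' : T4Family → ℝ)
variable (𝔸 : (F : T4Family) → Stage13HParams F 2 → Type*) (Ec : (F : T4Family) → Stage13HParams F 2 → Type*)
  [∀ (F : T4Family) (θ : Stage13HParams F 2), NormedAddCommGroup (Ec F θ)] [∀ (F : T4Family) (θ : Stage13HParams F 2), NormedSpace ℂ (Ec F θ)]
  (m' M : (F : T4Family) → Stage13HParams F 2 → ℕ) [hM0 : ∀ (F : T4Family) (θ : Stage13HParams F 2), NeZero (M F θ)]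
  (S : (F : T4Family) → (θ : Stage13HParams F 2) → (K : ℕ) → ClusterTower (F.P K) (𝔸 F θ) (M F θ))
  (emb : (F : T4Family) → (θ : Stage13HParams F 2) → ReadingMaps F (MatA 2) (𝔸 F θ)) (κ δ₀ ω cρ r E₀ B₃ θ₅ M₀ : (F : T4Family) → Stage13HParams F 2 → ℝ)
  (ι₁ : (F : T4Family) → (θ : Stage13HParams F 2) →
      (letI := θ.instVβ₁; letI := θ.instVβ₂;
      (g : ℕ → ℝ) → (k K : ℕ) → (domSys (F.P K) (M F θ) (k + 1)).Dom → ((Fin (F.P K).d → Site (F.P K) (k + 1) → θ.Vβ) →L[ℝ] (Ec F θ))))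
  (G₁ : (F : T4Family) → (θ : Stage13HParams F 2) → (g : ℕ → ℝ) → (k K : ℕ) → (domSys (F.P K) (M F θ) (k + 1)).Dom → (Ec F θ) → ℂ)
  (U₁ : (F : T4Family) → (θ : Stage13HParams F 2) → (g : ℕ → ℝ) → (k K : ℕ) → (domSys (F.P K) (M F θ) (k + 1)).Dom → Set (Ec F θ))
  (φ : (F : T4Family) → (θ : Stage13HParams F 2) → (k K : ℕ) → (domSys (F.P K) (M F θ) (k + 1)).Dom → (domSys (F.P (K + 1)) (M F θ) (k + 1)).Dom)
  (ιc : (F : T4Family) → (θ : Stage13HParams F 2) →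
      (letI := θ.instVβ₁; letI := θ.instVβ₂;
      (k : ℕ) → (Fin (k + 2) → ℝ) → (K : ℕ) → (domSys (F.P (K + 1)) (M F θ) (k + 1 + 1)).Dom → ((Fin (F.P (K + 1)).d → Site (F.P (K + 1)) (k + 1 + 1) → θ.Vβ) →L[ℝ] (Ec F θ))))
  (GB : (F : T4Family) → (θ : Stage13HParams F 2) → (k : ℕ) → (Fin (k + 2) → ℝ) → (K : ℕ) → (domSys (F.P (K + 1)) (M F θ) (k + 1 + 1)).Dom → (Ec F θ) → ℂ)
  (GA : (F : T4Family) → (θ : Stage13HParams F 2) → (k : ℕ) → (Fin (k + 2) → ℝ) → (K : ℕ) → (domSys (F.P (K + 1)) (M F θ) (k + 1 + 1)).Dom → (Ec F θ) → ℂ)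
  (U : (F : T4Family) → (θ : Stage13HParams F 2) → (k : ℕ) → (Fin (k + 2) → ℝ) → (K : ℕ) → (domSys (F.P (K + 1)) (M F θ) (k + 1 + 1)).Dom → Set (Ec F θ))

open Classical in
/-- ★★★ **THE ITEM `SpineGivenEndpointR13SepCoPHV` AT EVERY VERSION SLOT — LIVE: ALL PINS, EVERY SLOT AT ITS PRODUCER, N19′ AT THE BARE LEDGER READING WITH N16's LEAF ROWS PRODUCED,
NODE U3's LETTER ROWS FROM THE TERM-DATA PACKAGE; OFF-LIVE: ONE (B)-FREE TARGET ROW** (`N = 2`, guard `ZhUnity ∧ SlotsNondegenerate₁₃`, `hP := h.toCore`; `hr ∕ hinc ∕ hS :=`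
conjuncts 1 ∕ 2 ∕ 4 of dag-n18-w2's `u3LettersOfRecord₁₃_of_termwiseLocalTermData` at `θ.toStage13Params`, `s := 1`, `r := r_inc`, carried to the letter reading `ℓ F θ` by the DOMINATION rows `hℓκ hℓθ hℓC` (`windowedStepRateOfRecord₁₃_mono`); live =
APB16ᴮ §1 at `Rg := guard ∧ LiveSel` with `hsel := hRg.2` (N16's leaf rows from the family-level in-edges `ρ c εTop hloose hρε hεT h8P hU6loc hρb hc`); off-live = (Kꜰ)ᴮ
`bodyBFree₁₃CoPH_of_kernels_pin_bFree` at `crOneTerm₁₃ K₀`; FILE 1 `bodyBFree₁₃CoPH_of_split` + `hybridNE7Under_of_forSmallCouplings_stringwise` at `Node00.datumOfRecord₁₃SepCoPHV F 2 θ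
h v`, the slot's (B) ∕ endpoint binders discarded).  NOT a discharge; every row a HYPOTHESIS or a decided MODEL; W1-20's law, the term data, the term-level two-run bound and node N07's
sentences are DISPLAYED, asserted for no family; N11 NOT READ; no node discharged; K3⁸ OPEN. [bookkeeping] -/
theorem spineGivenEndpointR13SepCoPHV_of_liveV5PinsAtCrOfRecord₁₃VAt_cut_bareLedgerReadingV_n16Produced_offLiveOneTerm_v5pins_bFree_u3TermData
    (ksel : (F : T4Family) → (θ : Stage13HParams F 2) → θ.Provisos₁₃CoPH F 2 → (ℕ → ℝ) → List (ULoop F) → ℕ)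
    (hpin1 : Ne1PinnedOfRecord 𝔯)
    (hpin2 : ∃ (b aS : ℝ) (ν μ α β' : Fin 4) (c35 p : ℝ), 0 < b ∧ 0 < aS ∧
      ∀ (F : T4Family) (θ : Stage13HParams F 2) (hP : θ.Provisos₁₃CoPH F 2) (g₀ : ℕ → ℝ) (os : List (ULoop F)) (k : ℕ),
        (𝔯.lit F θ hP g₀ os).ne2 k = haveI := neZero_blockFactor F; fullGSizedObjects 3 F.hL b aS ν μ α β' c35 p)
    (hpinL : N16PinnedLoose 𝔯 ℓ₃ B)
    (hpin : ∀ (F : T4Family) (θ : Stage13HParams F 2) (hP : θ.Provisos₁₃CoPH F 2) (g₀ : ℕ → ℝ) (os : List (ULoop F)),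
      (𝔯.lit F θ hP g₀ os).u3 = objectsOfRecord₁₃ F 2 θ.toStage13Params (ℓ F θ))
    (h16 : ∀ (F : T4Family), (∃ θ : Stage13HParams F 2, θ.Provisos₁₃CoPH F 2 ∧ (θ.ZhUnity F 2 ∧ θ.SlotsNondegenerate₁₃ F 2) ∧ θ.Admissible F 2) →
      N16HolderAt (ne3OfRecord₁₁ F { ne3ConstLayerOfRecord₁₁ F 2 (ℓ₃ F) with
        dom := {V | V ∈ ne3DomOfRecord₁₁ F 2 0 0 ∧ V ∈ sfClass 4 F.L (ne3NperOfRecord₁₁ F 0 0) ((ℓ₃ F).ε / B F) 0} }) β)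
    (hs : ∀ (F : T4Family) (θ : Stage13HParams F 2), θ.Provisos₁₃CoPH F 2 → (θ.ZhUnity F 2 ∧ θ.SlotsNondegenerate₁₃ F 2) → θ.Admissible F 2 → (ℓ F θ).Signs)
    (hκ : ∀ (F : T4Family) (θ : Stage13HParams F 2), θ.Provisos₁₃CoPH F 2 → (θ.ZhUnity F 2 ∧ θ.SlotsNondegenerate₁₃ F 2) → θ.Admissible F 2 → 0 < (ℓ F θ).κ)
    (hcr : ∀ (F : T4Family) (θ : Stage13HParams F 2), θ.Provisos₁₃CoPH F 2 → (θ.ZhUnity F 2 ∧ θ.SlotsNondegenerate₁₃ F 2) → θ.Admissible F 2 →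
      betaPrime510 4 1 (ℓ F θ).κ ≤ (ℓ F θ).cr)
    (hκ₀ : ∀ (F : T4Family) (θ : Stage13HParams F 2), θ.Provisos₁₃CoPH F 2 → (θ.ZhUnity F 2 ∧ θ.SlotsNondegenerate₁₃ F 2) → θ.Admissible F 2 → kappa₀ (4 * 2 ^ 4) (2 * 4) ≤ (ℓ F θ).κ)
    (hM : ∀ (F : T4Family) (θ : Stage13HParams F 2), M F θ = F.L ^ m' F θ)
    (hloc : ∀ (F : T4Family) (θ : Stage13HParams F 2), θ.Provisos₁₃CoPH F 2 → (θ.ZhUnity F 2 ∧ θ.SlotsNondegenerate₁₃ F 2) → θ.Admissible F 2 →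
      Localizes17OfRecord₁₃ F 2 θ.toStage13Params (S F θ) (emb F θ))
    (hκ0 : ∀ (F : T4Family) (θ : Stage13HParams F 2), 0 < (κ F θ)) (hδ₀ : ∀ (F : T4Family) (θ : Stage13HParams F 2), 0 < (δ₀ F θ))
    (hκ4 : ∀ (F : T4Family) (θ : Stage13HParams F 2), kappa₀ (4 * 2 ^ 4) (2 * 4) ≤ (κ F θ) / 2 / 2) (hω : ∀ (F : T4Family) (θ : Stage13HParams F 2), 0 < (ω F θ))
    (hω1 : ∀ (F : T4Family) (θ : Stage13HParams F 2), (ω F θ) < 1) (hcρ : ∀ (F : T4Family) (θ : Stage13HParams F 2), 0 < (cρ F θ))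
    (hr0 : ∀ (F : T4Family) (θ : Stage13HParams F 2), 0 < (r F θ)) (hE₀ : ∀ (F : T4Family) (θ : Stage13HParams F 2), 0 ≤ (E₀ F θ))
    (hB₃ : ∀ (F : T4Family) (θ : Stage13HParams F 2), 0 ≤ (B₃ F θ)) (hU₁ : ∀ (F : T4Family) (θ : Stage13HParams F 2), ∀ g k K X, IsOpen ((U₁ F θ) g k K X))
    (hG₁ : ∀ (F : T4Family) (θ : Stage13HParams F 2), ∀ g k K X, DifferentiableOn ℂ ((G₁ F θ) g k K X) ((U₁ F θ) g k K X))
    (hrU₁ : ∀ (F : T4Family) (θ : Stage13HParams F 2), ∀ g k K X, Metric.ball (0 : Ec F θ) (r F θ) ⊆ (U₁ F θ) g k K X)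
    (hf₁ : ∀ (F : T4Family) (θ : Stage13HParams F 2), θ.Provisos₁₃CoPH F 2 → (θ.ZhUnity F 2 ∧ θ.SlotsNondegenerate₁₃ F 2) → θ.Admissible F 2 →
      (letI := θ.instVβ₁; letI := θ.instVβ₂;
      ∀ g ∈ Window θ.γ, ∀ (k K : ℕ) (X : (domSys (F.P K) (M F θ) (k + 1)).Dom) (B : Fin (F.P K).d → Site (F.P K) (k + 1) → θ.Vβ),
      expChart (fun W' => ((((S F θ) K) k).E (histPrefix g k) ((emb F θ) K k W') X).re) θ.ρ8 B = ((G₁ F θ) g k K X ((ι₁ F θ) g k K X B)).re))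
    (hsup₁ : ∀ (F : T4Family) (θ : Stage13HParams F 2), θ.Provisos₁₃CoPH F 2 → (θ.ZhUnity F 2 ∧ θ.SlotsNondegenerate₁₃ F 2) → θ.Admissible F 2 →
      ∀ g ∈ Window θ.γ, ∀ (k K : ℕ) (X : (domSys (F.P K) (M F θ) (k + 1)).Dom), ∀ ζ ∈ Metric.ball (0 : Ec F θ) (r F θ), ‖(G₁ F θ) g k K X ζ‖ ≤ (E₀ F θ) * Real.exp (-(κ F θ) * torusTreeLen X.1))
    (htail₁ : ∀ (F : T4Family) (θ : Stage13HParams F 2), θ.Provisos₁₃CoPH F 2 → (θ.ZhUnity F 2 ∧ θ.SlotsNondegenerate₁₃ F 2) → θ.Admissible F 2 →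
      (letI := θ.instVβ₁; letI := θ.instVβ₂; letI := θ.instιβ;
      ∀ (g : ℕ → ℝ) (k K : ℕ) (X : (domSys (F.P K) (M F θ) (k + 1)).Dom) (l : Fin (F.P K).d) (t : Site (F.P K) (k + 1)) (c : θ.ιβ),
      let e : Site (F.P K) (k + 1) → TPt 4 (domCount (F.P K) (M F θ) (k + 1) * (M F θ)) := fun x i => (ZMod.cast (x i) : ZMod (domCount (F.P K) (M F θ) (k + 1) * (M F θ)));
      ‖(ι₁ F θ) g k K X (Pi.single l (Pi.single t (θ.bV c)))‖ ≤ (B₃ F θ) * Real.exp (-(δ₀ F θ) * distCT (domCount (F.P K) (M F θ) (k + 1)) (M F θ) (e t) (nearT (M := M F θ) (e t) X))))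
    (hφ : ∀ (F : T4Family) (θ : Stage13HParams F 2), θ.Provisos₁₃CoPH F 2 → (θ.ZhUnity F 2 ∧ θ.SlotsNondegenerate₁₃ F 2) → θ.Admissible F 2 →
      ∀ k : ℕ, ∃ Km : ℕ, ∀ K, Km ≤ K → ∀ R : ℝ, 0 ≤ R → R ≤ (cρ F θ) * K →
      Set.BijOn ((φ F θ) k K)
      ↑(Finset.univ.filter (fun X : (domSys (F.P K) (M F θ) (k + 1)).Dom =>
      ¬ (R < torusTreeLen X.1 ∨ R < distCT (domCount (F.P K) (M F θ) (k + 1)) (M F θ)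
      (fun i : Fin 4 => (ZMod.cast (siteOfInt F K (k + 1) 0 i) : ZMod (domCount (F.P K) (M F θ) (k + 1) * (M F θ))))
      (nearT (M := M F θ) (fun i : Fin 4 => (ZMod.cast (siteOfInt F K (k + 1) 0 i) : ZMod (domCount (F.P K) (M F θ) (k + 1) * (M F θ)))) X))))
      ↑(Finset.univ.filter (fun X : (domSys (F.P (K + 1)) (M F θ) (k + 1)).Dom =>
      ¬ (R < torusTreeLen X.1 ∨ R < distCT (domCount (F.P (K + 1)) (M F θ) (k + 1)) (M F θ)
      (fun i : Fin 4 => (ZMod.cast (siteOfInt F (K + 1) (k + 1) 0 i) : ZMod (domCount (F.P (K + 1)) (M F θ) (k + 1) * (M F θ))))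
      (nearT (M := M F θ) (fun i : Fin 4 => (ZMod.cast (siteOfInt F (K + 1) (k + 1) 0 i) : ZMod (domCount (F.P (K + 1)) (M F θ) (k + 1) * (M F θ)))) X)))))
    (hterm : ∀ (F : T4Family) (θ : Stage13HParams F 2), θ.Provisos₁₃CoPH F 2 → (θ.ZhUnity F 2 ∧ θ.SlotsNondegenerate₁₃ F 2) → θ.Admissible F 2 →
      (letI := θ.instVβ₁; letI := θ.instVβ₂; letI := θ.instιβ;
      ∀ g ∈ Window θ.γ, ∀ (k : ℕ) (μ ν : Fin 4) (z : Fin 4 → ℤ), ∃ (Ks : ℕ) (A₁ : ℝ), 0 ≤ A₁ ∧ ∀ K, Ks ≤ K → ∀ R : ℝ, 0 ≤ R → R ≤ (cρ F θ) * K →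
      ∀ X ∈ Finset.univ.filter (fun X : (domSys (F.P K) (M F θ) (k + 1)).Dom =>
      ¬ (R < torusTreeLen X.1 ∨ R < distCT (domCount (F.P K) (M F θ) (k + 1)) (M F θ)
      (fun i : Fin 4 => (ZMod.cast (siteOfInt F K (k + 1) 0 i) : ZMod (domCount (F.P K) (M F θ) (k + 1) * (M F θ))))
      (nearT (M := M F θ) (fun i : Fin 4 => (ZMod.cast (siteOfInt F K (k + 1) 0 i) : ZMod (domCount (F.P K) (M F θ) (k + 1) * (M F θ)))) X))),
      |polScalar (fun W' => ((((S F θ) (K + 1)) k).E (histPrefix g k) ((emb F θ) (K + 1) k W') ((φ F θ) k K X)).re) θ.ρ8 θ.bV (Fin.cast (F.P_d (K + 1)).symm μ)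
      (siteOfInt F (K + 1) (k + 1) z) (Fin.cast (F.P_d (K + 1)).symm ν) (siteOfInt F (K + 1) (k + 1) 0) -
      polScalar (fun W' => ((((S F θ) K) k).E (histPrefix g k) ((emb F θ) K k W') X).re) θ.ρ8 θ.bV (Fin.cast (F.P_d K).symm μ) (siteOfInt F K (k + 1) z)
      (Fin.cast (F.P_d K).symm ν) (siteOfInt F K (k + 1) 0)| ≤ A₁ * (ω F θ) ^ K))
    (hθ₅ : ∀ (F : T4Family) (θ : Stage13HParams F 2), 0 ≤ (θ₅ F θ)) (hM₀ : ∀ (F : T4Family) (θ : Stage13HParams F 2), 0 ≤ (M₀ F θ))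
    (hU : ∀ (F : T4Family) (θ : Stage13HParams F 2), ∀ k w K X, IsOpen ((U F θ) k w K X))
    (hGB : ∀ (F : T4Family) (θ : Stage13HParams F 2), ∀ k w K X, DifferentiableOn ℂ ((GB F θ) k w K X) ((U F θ) k w K X))
    (hGA : ∀ (F : T4Family) (θ : Stage13HParams F 2), ∀ k w K X, DifferentiableOn ℂ ((GA F θ) k w K X) ((U F θ) k w K X))
    (hrU : ∀ (F : T4Family) (θ : Stage13HParams F 2), ∀ k w K X, Metric.ball (0 : Ec F θ) (r F θ) ⊆ (U F θ) k w K X)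
    (hfB : ∀ (F : T4Family) (θ : Stage13HParams F 2), θ.Provisos₁₃CoPH F 2 → (θ.ZhUnity F 2 ∧ θ.SlotsNondegenerate₁₃ F 2) → θ.Admissible F 2 →
      (letI := θ.instVβ₁; letI := θ.instVβ₂;
      ∀ (k : ℕ) (w : Fin (k + 2) → ℝ), w ∈ Box θ.γ (k + 1) → ∀ (K : ℕ) (X : (domSys (F.P (K + 1)) (M F θ) (k + 1 + 1)).Dom) (B),
      expChart (fun W' => ((((S F θ) (K + 1)) (k + 1)).E w ((emb F θ) (K + 1) (k + 1) W') X).re) θ.ρ8 B = ((GB F θ) k w K X ((ιc F θ) k w K X B)).re))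
    (hfA : ∀ (F : T4Family) (θ : Stage13HParams F 2), θ.Provisos₁₃CoPH F 2 → (θ.ZhUnity F 2 ∧ θ.SlotsNondegenerate₁₃ F 2) → θ.Admissible F 2 →
      (letI := θ.instVβ₁; letI := θ.instVβ₂;
      ∀ (k : ℕ) (w : Fin (k + 2) → ℝ), w ∈ Box θ.γ (k + 1) → ∀ (K : ℕ) (X : (domSys (F.P (K + 1)) (M F θ) (k + 1 + 1)).Dom) (B),
      expChart (fun W' : Fin (F.P (K + 1)).d → Site (F.P (K + 1)) (k + 1 + 1) → MatA 2 =>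
      ((((S F θ) K) k).E (Fin.tail w) ((emb F θ) K k (fun κ' y => W' κ' (siteShift (ladder F K k) y))) (castDom (domSys_succ F (M F θ) K (k + 1)) X)).re) θ.ρ8 B =
      ((GA F θ) k w K X ((ιc F θ) k w K X B)).re))
    (hsup : ∀ (F : T4Family) (θ : Stage13HParams F 2), θ.Provisos₁₃CoPH F 2 → (θ.ZhUnity F 2 ∧ θ.SlotsNondegenerate₁₃ F 2) → θ.Admissible F 2 →
      ∀ (k : ℕ) (w : Fin (k + 2) → ℝ), w ∈ Box θ.γ (k + 1) → ∀ (K : ℕ) (X : (domSys (F.P (K + 1)) (M F θ) (k + 1 + 1)).Dom), ∀ ζ ∈ Metric.ball (0 : Ec F θ) (r F θ),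
      ‖(GB F θ) k w K X ζ - (GA F θ) k w K X ζ‖ ≤ (M₀ F θ) * (θ₅ F θ) ^ (k + 1) * Real.exp (-(κ F θ) * torusTreeLen X.1))
    (htail : ∀ (F : T4Family) (θ : Stage13HParams F 2), θ.Provisos₁₃CoPH F 2 → (θ.ZhUnity F 2 ∧ θ.SlotsNondegenerate₁₃ F 2) → θ.Admissible F 2 →
      (letI := θ.instVβ₁; letI := θ.instVβ₂; letI := θ.instιβ;
      ∀ (k : ℕ) (w : Fin (k + 2) → ℝ) (K : ℕ) (X : (domSys (F.P (K + 1)) (M F θ) (k + 1 + 1)).Dom) (l : Fin (F.P (K + 1)).d) (t : Site (F.P (K + 1)) (k + 1 + 1)) (c : θ.ιβ),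
      let e : Site (F.P (K + 1)) (k + 1 + 1) → TPt 4 (domCount (F.P (K + 1)) (M F θ) (k + 1 + 1) * (M F θ)) :=
      fun x i => (ZMod.cast (x i) : ZMod (domCount (F.P (K + 1)) (M F θ) (k + 1 + 1) * (M F θ)));
      ‖(ιc F θ) k w K X (Pi.single l (Pi.single t (θ.bV c)))‖ ≤ (B₃ F θ) * Real.exp (-(δ₀ F θ) * distCT (domCount (F.P (K + 1)) (M F θ) (k + 1 + 1)) (M F θ) (e t) (nearT (M := M F θ) (e t) X))))
    (hℓκ : ∀ (F : T4Family) (θ : Stage13HParams F 2), θ.Provisos₁₃CoPH F 2 → (θ.ZhUnity F 2 ∧ θ.SlotsNondegenerate₁₃ F 2) → θ.Admissible F 2 → (ℓ F θ).κ ≤ delta1 (δ₀ F θ) (κ F θ) ((M F θ : ℝ) * 4))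
    (hℓθ : ∀ (F : T4Family) (θ : Stage13HParams F 2), θ.Provisos₁₃CoPH F 2 → (θ.ZhUnity F 2 ∧ θ.SlotsNondegenerate₁₃ F 2) → θ.Admissible F 2 → θ₅ F θ ≤ (ℓ F θ).θ₅)
    (hℓC : ∀ (F : T4Family) (θ : Stage13HParams F 2), θ.Provisos₁₃CoPH F 2 → (θ.ZhUnity F 2 ∧ θ.SlotsNondegenerate₁₃ F 2) → θ.Admissible F 2 →
      16 * M₀ F θ * B₃ F θ ^ 2 / r F θ ^ 2 * Real.exp (delta1 (δ₀ F θ) (κ F θ) ((M F θ : ℝ) * 4) * ((M F θ : ℝ) * 4) * 3) * B12TreeDecay.K₀ (4 * 2 ^ 4) (2 * 4) * K₁ 4 (δ₀ F θ / 2) * θ₅ F θ ≤ (ℓ F θ).C₅ * (ℓ F θ).θ₅)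
    (h9 : ∀ (F : T4Family) (θ : Stage13HParams F 2), θ.Provisos₁₃CoPH F 2 → (θ.ZhUnity F 2 ∧ θ.SlotsNondegenerate₁₃ F 2) → θ.Admissible F 2 →
      WindowedNE9OfRecord₁₃ F 2 θ.toStage13Params (ℓ F θ).κ (ℓ F θ).moduli)
    (hWall : ∀ (μ ν : Fin 4) (F : T4Family) (θ : Stage13HParams F 2), θ.Provisos₁₃CoPH F 2 → (θ.ZhUnity F 2 ∧ θ.SlotsNondegenerate₁₃ F 2) → θ.Admissible F 2 →
      WindowedDecayOfRecord₁₃ F 2 θ.toStage13Params μ ν (ℓ F θ).κ)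
    (hβ23 : 2 / 3 < β) (hβ1 : β ≤ 1)
    (hmatch : ∀ F : T4Family, 0 < B F ∧ (ℓ₃ F).ε / B F ≤ (ℓ₃ F).b)
    (hend : N16LettersEnd 2 g ℓ₃)
    (hradii : ∀ F : T4Family, (ℓ₃ F).g = gradConst 4 (c' F) ∧ 0 ≤ c' F ∧ 0 < c' F ∧ (ℓ₃ F).b ≤ c' F ∧
      (2 : ℝ) ^ 91 * (F.L : ℝ) ^ 17 * c' F ≤ 1 ∧ (2 : ℝ) ^ 76 * (F.L : ℝ) ^ 12 * c' F ≤ (ℓ₃ F).ε ∧ (ℓ₃ F).ε / B F ≤ 1 / 4 ∧ 4 * ((ℓ₃ F).ε / B F) ≤ c' F)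
    (hclass : ∀ F : T4Family, 16 * B7Prop2Explicit.C0 4 * (ℓ₃ F).ε ≤ 3 ∧ 1024 * (4 + 1) * (4 + 4) * (F.L : ℝ) ^ 2 * (ℓ₃ F).ε ≤ 1)
    (ρ c εTop : T4Family → ℝ)
    (hloose : ∀ F : T4Family, LeafH3sup 4 F.L (ne3NperOfRecord₁₁ F 0 0) (ρ F) (ρ F) (c F)
      ({V | V ∈ ne3DomOfRecord₁₁ F 2 0 0 ∧ V ∈ sfClass 4 F.L (ne3NperOfRecord₁₁ F 0 0) ((ℓ₃ F).ε / B F) 0} : Set (B7Prop1Explicit.Site 4 → Fin 4 → (Node00.MatA 2)ˣ)))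
    (hρε : ∀ F : T4Family, ρ F ≤ (ℓ₃ F).ε)
    (hεT : ∀ F : T4Family, (ℓ₃ F).ε ≤ εTop F)
    (h8P : ∀ (F : T4Family), ∀ V ∈ ({V | V ∈ ne3DomOfRecord₁₁ F 2 0 0 ∧ V ∈ sfClass 4 F.L (ne3NperOfRecord₁₁ F 0 0) ((ℓ₃ F).ε / B F) 0} :
        Set (B7Prop1Explicit.Site 4 → Fin 4 → (Node00.MatA 2)ˣ)), ∀ k : ℕ, ∃ U₀ : B7Prop1Explicit.Site 4 → Fin 4 → (Node00.MatA 2)ˣ,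
      U₀ ∈ sfClass 4 F.L (ne3NperOfRecord₁₁ F 0 0) (ρ F) (k + 1) ∧
        IsMinimiser 4 (sfClass 4 F.L (ne3NperOfRecord₁₁ F 0 0) (εTop F)) F.L (ne3NperOfRecord₁₁ F 0 0) (k + 1) V U₀)
    (hU6loc : ∀ (F : T4Family) (k : ℕ), ∀ V ∈ ({V | V ∈ ne3DomOfRecord₁₁ F 2 0 0 ∧ V ∈ sfClass 4 F.L (ne3NperOfRecord₁₁ F 0 0) ((ℓ₃ F).ε / B F) 0} :
        Set (B7Prop1Explicit.Site 4 → Fin 4 → (Node00.MatA 2)ˣ)),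
      ∀ U₀ : B7Prop1Explicit.Site 4 → Fin 4 → (Node00.MatA 2)ˣ, IsMinimiser 4 (sfClass 4 F.L (ne3NperOfRecord₁₁ F 0 0) (ρ F)) F.L (ne3NperOfRecord₁₁ F 0 0) (k + 1) V U₀ →
      ∀ U : B7Prop1Explicit.Site 4 → Fin 4 → (Node00.MatA 2)ˣ, U ∈ sfClass 4 F.L (ne3NperOfRecord₁₁ F 0 0) (εTop F) (k + 1) → B7Prop2Explicit.avgIter F.L U (k + 1) = V →
        U ∈ sfClass 4 F.L (ne3NperOfRecord₁₁ F 0 0) (ℓ₃ F).ε (k + 1) →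
        IsLocalMinOn (fun W : B7Prop1Explicit.Site 4 → Fin 4 → (Node00.MatA 2)ˣ => MinimalActionLevels.levelAction 4 F.L (ne3NperOfRecord₁₁ F 0 0) (k + 1) W)
          (MinimalActionSandwich.admissible (sfClass 4 F.L (ne3NperOfRecord₁₁ F 0 0) (εTop F)) F.L (k + 1) V) U →
        ∃ u : B7Prop1Explicit.Site 4 → (Node00.MatA 2)ˣ, IsUnitarySite u ∧ IsPeriodicSite u ((ne3NperOfRecord₁₁ F 0 0 * F.L ^ (k + 1) : ℕ) : ℤ) ∧ B7Prop1Explicit.gaugeAct u U₀ = U)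
    (hρb : ∀ F : T4Family, ρ F ≤ (ℓ₃ F).b)
    (hc : ∀ F : T4Family, c F ≤ c' F)
    (hβw : ∀ (F : T4Family) (θ : Stage13HParams F 2) (hP : θ.Provisos₁₃CoPH F 2), (θ.ZhUnity F 2 ∧ θ.SlotsNondegenerate₁₃ F 2) → θ.Admissible F 2 →
      ∃ γ₀ b b' : ℝ, 0 < γ₀ ∧ 0 < b ∧ DagBinding.BetaBoundsInInterval (datumOfRecord₁₃CoPH F 2 θ hP).C.toB12 γ₀ b b')
    (hζm : ∀ (F : T4Family) (θ : Stage13HParams F 2), θ.Provisos₁₃CoPH F 2 → ((θ.ZhUnity F 2 ∧ θ.SlotsNondegenerate₁₃ F 2) ∧ θ.ppSel = ppSelLiveOfRecord F 2 θ.ν θ.τ9 (EOfRecord₁₃ F 2 θ.toStage13Params) (wOfRecord₉ F 2 θ.toStage9Params)) → θ.Admissible F 2 →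
      ZetaMeasurable F 2 θ.ζ)
    (h20 : ∀ (F : T4Family) (θ : Stage13HParams F 2) (hP : θ.Provisos₁₃CoPH F 2), ((θ.ZhUnity F 2 ∧ θ.SlotsNondegenerate₁₃ F 2) ∧ θ.ppSel = ppSelLiveOfRecord F 2 θ.ν θ.τ9 (EOfRecord₁₃ F 2 θ.toStage13Params) (wOfRecord₉ F 2 θ.toStage9Params)) → θ.Admissible F 2 →
      ∀ (g₀ : ℕ → ℝ) (os : List (ULoop F)),
        ∃ W : ℕ → ℝ, RelWeightBound 1 (classSet₁₃ θ K₀ g₀) (weightA₁₃ θ hP K₀ g₀ os) (weightB₁₃ θ hP K₀ g₀ os) (badClass₁₃ θ K₀ g₀ (jc F θ hP g₀ os)) W)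
    (h21 : ∀ (F : T4Family) (θ : Stage13HParams F 2) (hP : θ.Provisos₁₃CoPH F 2), ((θ.ZhUnity F 2 ∧ θ.SlotsNondegenerate₁₃ F 2) ∧ θ.ppSel = ppSelLiveOfRecord F 2 θ.ν θ.τ9 (EOfRecord₁₃ F 2 θ.toStage13Params) (wOfRecord₉ F 2 θ.toStage9Params)) → θ.Admissible F 2 →
      ∀ (g₀ : ℕ → ℝ) (os : List (ULoop F)),
        ∃ Wsh : ℕ → ℝ, ShellWeightBound 1 (classSet₁₃ θ K₀ g₀) (weightA₁₃ θ hP K₀ g₀ os) (weightB₁₃ θ hP K₀ g₀ os) (sh F θ hP g₀ os).1 (sh F θ hP g₀ os).2 Wsh)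
    (hlinkBareV : ∀ (F : T4Family) (θ : Stage13HParams F 2) (hP : θ.Provisos₁₃CoPH F 2), ((θ.ZhUnity F 2 ∧ θ.SlotsNondegenerate₁₃ F 2) ∧ θ.ppSel = ppSelLiveOfRecord F 2 θ.ν θ.τ9 (EOfRecord₁₃ F 2 θ.toStage13Params) (wOfRecord₉ F 2 θ.toStage9Params)) → θ.Admissible F 2 →
      ∀ (γ gIR b : ℝ) (g₀ : ℕ → ℝ), (datumOfRecord₁₃CoPH F 2 θ hP).Tuned γ gIR g₀ → γ ≤ θ.γ → γ ^ 2 ≤ Real.exp (-1) → 0 < b →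
      (∀ K m, 0 ≤ m → m < K → b ≤ (datumOfRecord₁₃CoPH F 2 θ hP).βfun m (prefixOf (runFlow (datumOfRecord₁₃CoPH F 2 θ hP) g₀ K) m)) →
      ∀ (os : List (ULoop F)) (k : ℕ),
      let S : SpineCarriers := crOfRecord₁₃VAt K₀ (jc F θ hP g₀ os) sh F θ hP g₀ os
      let R : RateCarriers 2 := rateCarriersOfRecord₁₃CoPH 𝔯 F θ hP g₀ os k
      let D : Datum F 2 := datumOfRecord₁₃CoPH F 2 θ hP
      letI := S.dec
      ∃ (_ : DecidableEq R.u3.C.Dom) (F' : Type) (ι' X' : Type) (_ : MeasurableSpace ι')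
        (L : LedgerDataSync R.u3.C F' ι' S.ι) (Rd : Readings ι' X') (bsel : (ℕ → ℝ) → ℝ) (EB : Functional R.u3.C R.u3.C.BgB)
        (g : ℕ → ℕ → ℝ)
        (uA : ℕ → ι' → R.u3.C.BgA) (uB : ℕ → ι' → R.u3.C.BgB)
        (Koff : ℕ) (cells : (K j : ℕ) → R.u3.C.Dom → Finset (Site (F.P (Koff + K)) j))
        (θ : ℝ)
        (rd : ι' → (B7Prop1Explicit.Site 4 → Fin 4 → (Matrix (Fin 2) (Fin 2) ℂ)ˣ)),
        (∀ K i, i ≤ K → g K i = runFlow D g₀ K i) ∧ (∀ K i, K < i → g K i = gIR) ∧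
        EB = (fun s => R.u3.EB (bsel s) s) ∧
        (∀ (Sz : ℕ → ℝ → S.ι → ℕ → ℝ) (E₀ : ℝ) (m : ℕ) (a : ℝ) (Cw Λg : ℝ),
          (∀ K t, |t| ≤ S.l₀ → ∀ τ ∈ S.T K \ S.Bad K t, ∀ v ∈ Rd.dom, ∀ j ≤ K,
            |∑ X ∈ L.fac K t τ with R.u3.C.scale X = j,
                (Real.log (Real.exp (EB (fun i => g (K + 1) (i + 1)) (uB K v) X
                    - EB (fun i => g (K + 1) (i + 1)) L.oneB X))
                  - Real.log (Real.exp (R.u3.EA (g K) (uA K v) X - R.u3.EA (g K) L.oneA X)))| ≤ Sz K t τ j) →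
          0 ≤ E₀ → 0 < a → a < 1 →
          (∀ K t, |t| ≤ S.l₀ → ∀ τ ∈ S.T K \ S.Bad K t, ∀ j ≤ K,
            Sz K t τ j ≤ S.vol * (E₀ * ((K : ℝ) + 1) ^ m * a ^ (K - j))) →
          (∀ K, Multiplicity (L.All K) R.u3.C.scale (fun X => Real.exp (-(R.u3.κ * R.u3.C.d X))) Cw S.vol Λg K) →
          (∀ K t, |t| ≤ S.l₀ → ∀ τ ∈ S.T K \ S.Bad K t,
            WindowMultiplicity (L.facO K t τ) L.scO L.wO Cw S.vol Λg (jlogOf L.Cl K) K) →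
          1 ≤ Λg → L.θ' ≤ Λg →
          LedgerAtSync { L with S := Sz, E₀ := E₀, m := m, a := a, Cw := Cw, Λg := Λg } S.l₀ S.vol S.T S.Bad
            (fun K t τ => S.A K t τ - S.shA K t τ) (fun K t τ => S.B K t τ - S.shB K t τ) Rd R.u3.EA EB R.u3.κ g uA uB
            R.u3.ω R.u3.ρ R.u3.θ (θ ^ ((3 : ℝ) * β - 2))) ∧
        (∀ K t, |t| ≤ S.l₀ → ∀ τ ∈ S.T K \ S.Bad K t,
          WindowMultiplicity (L.facO K t τ) L.scO L.wO L.Cw S.vol L.Λg (jlogOf L.Cl K) K) ∧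
        0 ≤ L.Cw ∧ 1 ≤ L.Λg ∧ L.θ' ≤ L.Λg ∧
        (∀ K, ∀ X ∈ L.All K,
          (cells K (R.u3.C.scale X + Koff) X).Nonempty ∧ TFaceConnected (cells K (R.u3.C.scale X + Koff) X)) ∧
        (∀ K j, Set.InjOn (cells K j) ↑((L.All K).filter fun X => R.u3.C.scale X + Koff = j)) ∧
        (∀ K, ∀ X ∈ L.All K, torusTreeLen (cells K (R.u3.C.scale X + Koff) X) ≤ R.u3.C.d X) ∧
        0 < θ ∧ θ ^ 6 = ((R.ne3.L : ℝ))⁻¹ ∧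
        (∀ v ∈ Rd.dom, rd v ∈ R.ne3.dom) ∧
        (∀ k, ∀ v ∈ Rd.dom, Rd.act k v = minAct 4 (sfClass 4 R.ne3.L R.ne3.Nper R.ne3.ε) R.ne3.L R.ne3.Nper k (rd v)) ∧
        (R.ne3.Nper : ℝ) ^ 4 ≤ Rd.vol ∧
        (∀ s ∈ Window γ, 0 < bsel s ∧ bsel s ≤ γ))
    (htarget : ∀ (F : T4Family) (θ : Stage13HParams F 2) (hP : θ.Provisos₁₃CoPH F 2), ((θ.ZhUnity F 2 ∧ θ.SlotsNondegenerate₁₃ F 2) ∧ ¬ θ.ppSel = ppSelLiveOfRecord F 2 θ.ν θ.τ9 (EOfRecord₁₃ F 2 θ.toStage13Params) (wOfRecord₉ F 2 θ.toStage9Params)) → θ.Admissible F 2 →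
        ForSmallCouplings (datumOfRecord₁₃CoPH F 2 θ hP) fun g₀ => ∀ os : List (ULoop F),
          (RatesHolderAt (datumOfRecord₁₃CoPH F 2 θ hP) (rateCarriersOfRecord₁₃CoPH 𝔯 F θ hP g₀ os (ksel F θ hP g₀ os)) β ∧
              ReadOutAt (datumOfRecord₁₃CoPH F 2 θ hP) (rateCarriersOfRecord₁₃CoPH 𝔯 F θ hP g₀ os (ksel F θ hP g₀ os)).u3 ∧
              (0 ≤ (rateCarriersOfRecord₁₃CoPH 𝔯 F θ hP g₀ os (ksel F θ hP g₀ os)).u3.ρ ∧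
                (rateCarriersOfRecord₁₃CoPH 𝔯 F θ hP g₀ os (ksel F θ hP g₀ os)).u3.ρ < 1)) →
            ∃ δ : ℕ → ℝ, Target ((F.side : ℝ) ^ 4) 1 δ (fun K => T4GenFunBounds.schemeZ ((datumOfRecord₁₃CoPH F 2 θ hP).scheme g₀) os (K₀ + K))) :
    SpineGivenEndpointR13SepCoPHV := by
  have hρ : ∀ (F : T4Family) (θ : Stage13HParams F 2), θ.Provisos₁₃CoPH F 2 → (θ.ZhUnity F 2 ∧ θ.SlotsNondegenerate₁₃ F 2) → θ.Admissible F 2 →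
      0 ≤ (ℓ F θ).ρ ∧ (ℓ F θ).ρ < 1 := fun F θ hP hG hθ => ⟨(hs F θ hP hG hθ).ρ_nonneg, (hs F θ hP hG hθ).ρ_lt_one⟩
  have hTD := fun (F : T4Family) (θ : Stage13HParams F 2) (hP : θ.Provisos₁₃CoPH F 2) (hG : (θ.ZhUnity F 2 ∧ θ.SlotsNondegenerate₁₃ F 2)) (hθ : θ.Admissible F 2) =>
    u3LettersOfRecord₁₃_of_termwiseLocalTermData F 2 (m' F θ) (M F θ) (hM F θ) θ.toStage13Params (S F θ) (emb F θ) (hloc F θ hP hG hθ) (hκ0 F θ) (hδ₀ F θ) (hκ4 F θ)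
      (hω F θ) (hω1 F θ) (hcρ F θ) (hr0 F θ) (hE₀ F θ) (hB₃ F θ) (ι₁ F θ) (G₁ F θ) (U₁ F θ) (hU₁ F θ) (hG₁ F θ) (hrU₁ F θ) (hf₁ F θ hP hG hθ) (hsup₁ F θ hP hG hθ)
      (htail₁ F θ hP hG hθ) (φ F θ) (hφ F θ hP hG hθ) (hterm F θ hP hG hθ) (hθ₅ F θ) (hM₀ F θ) (ιc F θ) (GB F θ) (GA F θ) (U F θ) (hU F θ) (hGB F θ) (hGA F θ) (hrU F θ)
      (hfB F θ hP hG hθ) (hfA F θ hP hG hθ) (hsup F θ hP hG hθ) (htail F θ hP hG hθ)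
  have hS' : ∀ (F : T4Family) (θ : Stage13HParams F 2), θ.Provisos₁₃CoPH F 2 → (θ.ZhUnity F 2 ∧ θ.SlotsNondegenerate₁₃ F 2) → θ.Admissible F 2 →
      WindowedStepRateOfRecord₁₃ F 2 θ.toStage13Params 1 (ℓ F θ).κ (ℓ F θ).θ₅ ((ℓ F θ).C₅ * (ℓ F θ).θ₅) := fun F θ hP hG hθ =>
    windowedStepRateOfRecord₁₃_mono F 2 θ.toStage13Params (hTD F θ hP hG hθ).2.2.2.1 (hℓκ F θ hP hG hθ) (hθ₅ F θ) (hℓθ F θ hP hG hθ) (hℓC F θ hP hG hθ)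
      (mul_nonneg (hs F θ hP hG hθ).C₅_nonneg (hs F θ hP hG hθ).θ₅_pos.le)
  have hUK := fun (F : T4Family) (θ : Stage13HParams F 2) (hP : θ.Provisos₁₃CoPH F 2) (hG : (θ.ZhUnity F 2 ∧ θ.SlotsNondegenerate₁₃ F 2)) (hθ : θ.Admissible F 2) =>
    u3KernelInputs_of_finiteVolumeLetters F 2 θ.toStage13Params (ℓ F θ) (hs F θ hP hG hθ) 1 (hTD F θ hP hG hθ).1 (hTD F θ hP hG hθ).2.1 (hS' F θ hP hG hθ)
      (h9 F θ hP hG hθ) (hWall 0 1 F θ hP hG hθ)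
  exact fun F θ h v hG hθ _ _ =>
    hybridNE7Under_of_forSmallCouplings_stringwise (Node00.datumOfRecord₁₃SepCoPHV F 2 θ h v)
      (show ForSmallCouplings (Node00.datumOfRecord₁₃SepCoPHV F 2 θ h v) (fun g₀ => StringwiseHybridNE7 ((Node00.datumOfRecord₁₃SepCoPHV F 2 θ h v).scheme g₀)) from
        bodyBFree₁₃CoPH_of_split (fun F (θ : Stage13HParams F 2) => (θ.ZhUnity F 2 ∧ θ.SlotsNondegenerate₁₃ F 2)) (fun F (θ : Stage13HParams F 2) => θ.ppSel = ppSelLiveOfRecord F 2 θ.ν θ.τ9 (EOfRecord₁₃ F 2 θ.toStage13Params) (wOfRecord₉ F 2 θ.toStage9Params))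
          (bodyBFree₁₃CoPH_of_v5pins_bareLedgerReadingV_n16Produced_at_crOfRecord₁₃VAt_cut K₀ jc sh β 𝔯 ℓ (fun _ _ => 1)
            (fun F θ => max (Real.exp (Real.log (ω F θ) / 2)) (Real.exp (-(min (κ F θ) (δ₀ F θ) / 2) * (-Real.log (ω F θ) / (2 * (max (2 * kappa₀ (4 * 2 ^ 4) (2 * 4) + 4) (-Real.log (ω F θ) / (2 * cρ F θ)) + 1)))))) ℓ₃ g B c'
          (fun F (θ : Stage13HParams F 2) => (θ.ZhUnity F 2 ∧ θ.SlotsNondegenerate₁₃ F 2) ∧ θ.ppSel = ppSelLiveOfRecord F 2 θ.ν θ.τ9 (EOfRecord₁₃ F 2 θ.toStage13Params) (wOfRecord₉ F 2 θ.toStage9Params))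
          ksel hpin1 hpin2 hpinL hpin (fun F hF => h16 F (hF.elim fun θ h => ⟨θ, h.1, h.2.1.1, h.2.2⟩)) (fun F θ hP hRg hθ => hs F θ hP hRg.1 hθ) (fun F θ hP hRg hθ => hκ F θ hP hRg.1 hθ)
          (fun F θ hP hRg hθ => hcr F θ hP hRg.1 hθ) (fun F θ hP hRg hθ => hκ₀ F θ hP hRg.1 hθ) (fun F θ hP hRg hθ => (hTD F θ hP hRg.1 hθ).1)
          (fun F θ hP hRg hθ => (hTD F θ hP hRg.1 hθ).2.1)
          (fun F θ hP hRg hθ => hS' F θ hP hRg.1 hθ) (fun F θ hP hRg hθ => h9 F θ hP hRg.1 hθ) (fun μ ν F θ hP hRg hθ => hWall μ ν F θ hP hRg.1 hθ) hβ23 hβ1 hmatch hend hradii hclass ρ c εTop hloose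
          hρε hεT h8P hU6loc hρb hc (fun F θ hP hRg hθ => hβw F θ hP hRg.1 hθ) (fun _ _ _ hRg _ => ⟨_, hRg.2⟩) hζm h20 h21 hlinkBareV)
          (bodyBFree₁₃CoPH_of_kernels_pin_bFree (crOneTerm₁₃ K₀) 𝔯 ksel (fun {F} (θ : Stage13HParams F 2) => ((θ.ZhUnity F 2 ∧ θ.SlotsNondegenerate₁₃ F 2) ∧ ¬ θ.ppSel = ppSelLiveOfRecord F 2 θ.ν θ.τ9 (EOfRecord₁₃ F 2 θ.toStage13Params) (wOfRecord₉ F 2 θ.toStage9Params))) ℓ β hpin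
            (fun F θ hP hRg hθ => ForSmallCouplings.of_forall fun g₀ os => by
              refine ⟨?_, ?_, ?_⟩
              · exact n14At_rateCarriersOfRecord₁₃CoPH_of_pinned 𝔯 hpin1 F θ hP g₀ os (ksel F θ hP g₀ os)
              · obtain ⟨b, aS, ν, μ, α, β', c35, p, hb, haS, h⟩ := hpin2
                rw [h F θ hP g₀ os]
                exact n15At_fullGSizedObjects_family hb haS ν μ α β' c35 p F
              · show N16HolderAt (rateCarriersOfRecord₁₃CoPH 𝔯 F θ hP g₀ os (ksel F θ hP g₀ os)).ne3 β
                rw [rateCarriers_ne3_of_pinnedLoose hpinL F θ hP g₀ os (ksel F θ hP g₀ os)]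
                exact h16 F ⟨θ, hP, hRg.1, hθ⟩)
            (fun F θ hP hRg hθ => hs F θ hP hRg.1 hθ) (fun F θ hP hRg hθ => hκ F θ hP hRg.1 hθ) (fun F θ hP hRg hθ => hcr F θ hP hRg.1 hθ)
            (fun F θ hP hRg hθ => hρ F θ hP hRg.1 hθ) (h20_shape_crOneTerm₁₃ K₀) (h21_shape_crOneTerm₁₃ K₀)
            (fun F θ hP hRg hθ => (htarget F θ hP hRg hθ).mono fun g₀ hg os hPr =>
              (core_crOneTerm₁₃_iff_target K₀ θ hP g₀ os).2 (hg os hPr))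
            (fun _ θ hP _ _ => ForSmallCouplings.of_forall fun g₀ os => extraction_crOneTerm₁₃ K₀ θ hP g₀ os)
            (fun F θ hP hRg hθ => (hUK F θ hP hRg.1 hθ).1) (fun F θ hP hRg hθ => (hUK F θ hP hRg.1 hθ).2.1)
            (fun F θ hP hRg hθ => (hUK F θ hP hRg.1 hθ).2.2))
          F θ h.toCore hG hθ) _

end Summit.QuantumFields.YangMills.Theorems.BalabanUVNodesN27SpineRecord
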